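import Mathlib
import Summits.NavierStokesRegularity.NavierStokesRegularity.Theses.SymmetryModuliCount
import Summits.NavierStokesRegularity.NavierStokesRegularity.Theorems.SymmetryModuliCountForcedSymmetryRigidComotionVanishing
import Literature.Analysis.FluidPDE.TypeIAncientMild
import HarnessLib

/-!
# Route SymmetryModuliCount — rigid co-motion is fatal on a backward end

Theorems file closing the support item stmt-NavierStokesRegularity-14063
(`Summit.NavierStokesRegularity.NavierStokesRegularity.Theses.SymmetryModuliCount.RigidComotionVanishesOnEnd`),
a hypothesis of the route's deciding theorem `closes` (the case "both scaling rates nonzero" of the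
time-anchor collapse):

* if a Type-I KNSS-mild ancient field `u ∈ A_C` (`IsTypeIAncientMild C u`) is annihilated on a
  backward end `t < θ`, `θ ≤ 0`, by the extended generator `τ∂ₜ + (a + Ax)·∇ − A` with `τ ≠ 0`
  and `A` skew (`⟪Ax, x⟫ = 0`), i.e. `D(u t)(x)(a + Ax) + τ ∂ₜu − A u = 0` for `t < θ`, then
  `u ≡ 0` on `t < θ`.

## Proof (reduction to the full slab `t < 0`)

The class `A_C` is invariant under backward time shifts (`IsTypeIAncientMild.comp_sub_right`,
KNSS 2009 §1): `v s := u (s − (−θ)) = u (s + θ)` is again in `A_C` since `−θ ≥ 0`, and for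
`s < 0` the point `s + θ < θ` lies in the end, so `v` is annihilated by the same generator on the
whole slab `s < 0` (`∂ₛ v (s, x) = ∂ₜ u (s + θ, x)`, `deriv_comp_sub_const`; the spatial slices are
literally the same functions). The slab case is the tree theorem
`Theorems.stub_rigidComotionVanishing` (file
`SymmetryModuliCountForcedSymmetryRigidComotionVanishing.lean`: characteristics of the affine
field, `‖u‖` constant along them because `A` is skew, and the Type-I rate `C/√(−t) → 0` at
`t → −∞`), which gives `v ≡ 0` on `s < 0`, i.e. `u t x = v (t − θ) x = 0` for `t < θ`.
Degenerate cases (`τ` of either sign, `A = 0`, `a = 0`) are covered by the slab theorem.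

## References

Elementary; PineauVicol2026 (arXiv:2607.09619) Rem 1.8 names the Killing solitons this kills.
No published proof is followed. [folklore]
-/

noncomputable section

-- the summit and its single sub-problem share the name (CONVENTIONS §1), as in every Theorems file
set_option linter.dupNamespace false

open Set Function
open Literature.Analysis.FluidPDE

namespace Summit.NavierStokesRegularity.NavierStokesRegularity.Theorems

/-- **Transport of the rigid co-motion identity under a backward time shift.** If
`D(u t)(y)(a + Ay) + τ ∂ₜu(t, y) − A u(t, y) = 0` for all `t < θ`, then the shifted field
`v s := u (s − δ)` with `δ = −θ` satisfies the same identity for all `s < 0`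
(`∂ₛ v(s, y) = ∂ₜ u(s − δ, y)` by `deriv_comp_sub_const`; the slices `v s = u (s − δ)` coincide).
[folklore] -/
theorem rigidComotion_gen_comp_sub_right
    {u : ℝ → EuclideanSpace ℝ (Fin 3) → EuclideanSpace ℝ (Fin 3)}
    {a : EuclideanSpace ℝ (Fin 3)} {A : EuclideanSpace ℝ (Fin 3) →L[ℝ] EuclideanSpace ℝ (Fin 3)}
    {τ θ : ℝ}
    (hgen : ∀ t < θ, ∀ x, fderiv ℝ (u t) x (a + A x) + τ • timeDeriv u t x - A (u t x) = 0) :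
    ∀ s < (0 : ℝ), ∀ x, fderiv ℝ ((fun r => u (r - (-θ))) s) x (a + A x)
      + τ • timeDeriv (fun r => u (r - (-θ))) s x - A ((fun r => u (r - (-θ))) s x) = 0 := by
  intro s hs x
  have hd : timeDeriv (fun r => u (r - (-θ))) s x = timeDeriv u (s - (-θ)) x := by
    simp only [timeDeriv_apply]
    exact deriv_comp_sub_const (f := fun r => u r x) (a := (-θ)) (x := s)
  rw [hd]
  exact hgen (s - (-θ)) (by linarith) x

/-- **Rigid co-motion is fatal on a backward end** (item stmt-NavierStokesRegularity-14063,
`RigidComotionVanishesOnEnd`, verbatim). If `u ∈ A_C` (`IsTypeIAncientMild C u`) is annihilated on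
`t < θ` (`θ ≤ 0`) by `τ∂ₜ + (a + Ax)·∇ − A` with `τ ≠ 0` and `A` skew, then `u ≡ 0` on `t < θ`.
Proof: shift time by `−θ ≥ 0` (`IsTypeIAncientMild.comp_sub_right`), transport the generator
identity (`rigidComotion_gen_comp_sub_right`), apply the slab theorem
`stub_rigidComotionVanishing`, and read the conclusion back at `s = t − θ < 0`. [folklore] -/
theorem symmetryModuliCount_rigidComotionVanishesOnEnd_proof :
    Summit.NavierStokesRegularity.NavierStokesRegularity.Theses.SymmetryModuliCount.RigidComotionVanishesOnEnd := by
  unfold Summit.NavierStokesRegularity.NavierStokesRegularity.Theses.SymmetryModuliCount.RigidComotionVanishesOnEnd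
  intro C u hu a A τ θ hA hτ hθ hgen t ht x
  -- the backward shift `v s := u (s - (-θ)) = u (s + θ)` is again in `A_C`
  have hv : IsTypeIAncientMild C (fun s => u (s - (-θ))) := hu.comp_sub_right (neg_nonneg.2 hθ)
  have key := stub_rigidComotionVanishing C (fun s => u (s - (-θ))) hv a A τ hA hτ
    (rigidComotion_gen_comp_sub_right hgen) (t - θ) (by linarith) x
  simpa using key

end Summit.NavierStokesRegularity.NavierStokesRegularity.Theorems

end
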